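import Summits.MatrixMultiplication.MatrixMultiplication.Theses.FidelityWitnesses
import Literature.Computability.AlgebraicComplexity.AlderStrassen

/-!
# Sketch — crux `LinearDefectLaw` (stmt-MatrixMultiplication-14039), crux-ideate round 1, ideator 1

First-lemma signatures for the two idea cards
* `critical-subformat-spectral-gap`  (full-group criticality ⇒ Hermitian slice compressions `K_p`,
  sub-format localisation of the residual, Spectral Gap Conjecture ⇒ top three rungs), and
* `unit-residual-telescoping`        (border-rank-free transfer: every nonzero closest-point
  residual has spectral norm ≥ 1; telescoping gives the law).
Everything here only has to ELABORATE (`lean check` rc 0); nothing is claimed proved.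
-/

set_option linter.dupNamespace false

namespace Summit.MatrixMultiplication.MatrixMultiplication.Cruxes.LinearDefectLaw.Ideator1

open scoped BigOperators ComplexConjugate
open Literature.Computability.AlgebraicComplexity
open Summit.MatrixMultiplication.MatrixMultiplication.Theses.FidelityWitnesses (LinearDefectLaw)

noncomputable section

/-- index type of one slot of `⟨n,n,n⟩` -/
abbrev P (n : ℕ) := Fin n × Fin n

/-- the tensor `T = ⟨n,n,n⟩` (Bläser slot order: output, X, Y) -/
abbrev T (n : ℕ) : P n → P n → P n → ℂ := matMulTensor ℂ n n n

/-- squared Frobenius distance -/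
def sqDist {n : ℕ} (A B : P n → P n → P n → ℂ) : ℝ := ∑ a, ∑ b, ∑ c, ‖A a b c - B a b c‖ ^ 2

/-- the closed cone `σ̂_r` = Euclidean closure of the rank-`≤ r` tensors (= `{algBorderRank ≤ r}`
by the tree's Alder–Strassen theorem `mem_closure_setOf_tensorRank_le_iff`). -/
def secantCone (n r : ℕ) : Set (P n → P n → P n → ℂ) :=
  closure {S | tensorRank S ≤ r}

/-- `S` is a closest point of `σ̂_r` to `⟨n,n,n⟩`. Such points exist (closed set, coercive
distance) and lie on the Thales sphere `⟨S, T − S⟩ = 0`. -/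
def IsClosestPoint (n r : ℕ) (S : P n → P n → P n → ℂ) : Prop :=
  S ∈ secantCone n r ∧ ∀ S' ∈ secantCone n r, sqDist (T n) S ≤ sqDist (T n) S'

/-! ## Card `critical-subformat-spectral-gap` -/

/-- mode-1 ("output") overlap matrix `n·K_A(S) = S_(A) T_(A)^*`:
entry `(a, a') = Σ_{b,c} S_{abc} · conj T_{a'bc}`. Modes 2, 3 are the cyclic analogues. -/
def overlapA {n : ℕ} (S : P n → P n → P n → ℂ) (a a' : P n) : ℂ :=
  ∑ b, ∑ c, S a b c * conj (T n a' b c)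

/-- mode-1 Gram matrix `S_(A) S_(A)^*`. -/
def gramA {n : ℕ} (S : P n → P n → P n → ℂ) (a a' : P n) : ℂ :=
  ∑ b, ∑ c, S a b c * conj (S a' b c)

def overlapB {n : ℕ} (S : P n → P n → P n → ℂ) (b b' : P n) : ℂ :=
  ∑ a, ∑ c, S a b c * conj (T n a b' c)

def gramB {n : ℕ} (S : P n → P n → P n → ℂ) (b b' : P n) : ℂ :=
  ∑ a, ∑ c, S a b c * conj (S a b' c)

def overlapC {n : ℕ} (S : P n → P n → P n → ℂ) (c c' : P n) : ℂ :=
  ∑ a, ∑ b, S a b c * conj (T n a b c')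

def gramC {n : ℕ} (S : P n → P n → P n → ℂ) (c c' : P n) : ℂ :=
  ∑ a, ∑ b, S a b c * conj (S a b c')

/-- **First lemma (L1, provable now): FULL-GROUP CRITICALITY.** At a closest point the first
variation along the Lie algebra `𝔤𝔩(A) ⊕ 𝔤𝔩(B) ⊕ 𝔤𝔩(C)` (which preserves `σ̂_r`) vanishes:
`⟨T − S, X·S⟩ = 0`, i.e. `S_(p) T_(p)^* = S_(p) S_(p)^*` in each of the three modes. Because
`T_(p) T_(p)^* = n·I` (the `n²` slices of `⟨n,n,n⟩` in each mode are orthogonal of norm² `n`), the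
matrix `K_p := S_(p)T_(p)^*/n` is then a Hermitian contraction `0 ⪯ K_p ⪯ I` with
`S = K_p ·_p T + Q_p`, `Q_pQ_p^* = n(K_p − K_p²)`, rows(`Q_p`) ⊥ slices, and the defect is spectral:
`‖T − S‖² = n · tr(I − K_p)` for every `p`. -/
def CriticalGramIdentity : Prop :=
  ∀ (n r : ℕ) (S : P n → P n → P n → ℂ), IsClosestPoint n r S →
    (∀ a a', overlapA S a a' = gramA S a a') ∧ (∀ b b', overlapB S b b' = gramB S b b') ∧
    (∀ c c', overlapC S c c' = gramC S c c')

/-- the spectral form of the defect at a closest point (consequence of L1): `d = n·tr(I − K_A)`,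
i.e. `Σ‖T − S‖² = n³ − Σ_a overlapA S a a` (real part; the sum is real and equals `Σ‖S‖²`). -/
def SpectralDefect : Prop :=
  ∀ (n r : ℕ) (S : P n → P n → P n → ℂ), IsClosestPoint n r S →
    sqDist (T n) S = (n : ℝ) ^ 3 - (∑ a, overlapA S a a).re

/-- **L2 (provable now from L1): SUB-FORMAT LOCALISATION of the residual.** Every `η` with
`K_A η = η` (an exactly reproduced output direction) annihilates `R = T − S` in mode 1:
`Σ_a conj(η_a) R_{abc} = 0`; with the cyclic analogues, `R ∈ E_A^⊥ ⊗ E_B^⊥ ⊗ E_C^⊥`,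
`E_p := ker(I − K_p)`, a sub-format of dimensions `m_p = rank(I − K_p)`. (Checks: `(2,6)`:
`m = (1,1,1)`, `R` = one unit product; `(2,5)` Bini: `m = (2,2,1)`, `R` of rank 2.) -/
def SubformatLocalisation : Prop :=
  ∀ (n r : ℕ) (S : P n → P n → P n → ℂ), IsClosestPoint n r S →
    ∀ η : P n → ℂ, (∀ a, ∑ a', overlapA S a a' * η a' = (n : ℂ) * η a) →
      ∀ b c, ∑ a, conj (η a) * (T n a b c - S a b c) = 0

/-- **SPECTRAL GAP CONJECTURE (SGC, mode 1; modes 2, 3 cyclic).** At a closest point every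
eigenvalue `κ` of `K_A` is either `1` or at most `1 − 1/n`: deficiency is quantised, never thin.
(Tight: deleting one product gives `κ = 1 − 1/n`; partial deletion `T − t·e`, `0 < t < 1`, would
give `κ = 1 − t/n` and is thereby predicted never to be a closest point — the UnitDefect necessary
condition of the dossier and the sibling's diagonal-pencil scan `dist²(T_u, σ₆) = min(|u|²,1)`.) -/
def SpectralGapConjecture : Prop :=
  ∀ (n r : ℕ) (S : P n → P n → P n → ℂ), IsClosestPoint n r S →
    ∀ (η : P n → ℂ) (κ : ℝ), η ≠ 0 → (∀ a, ∑ a', overlapA S a a' * η a' = ((n : ℂ) * κ) * η a) →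
      κ = 1 ∨ κ ≤ 1 - 1 / (n : ℝ)

/-- UnitDefect (the `k = 1` rung of the dossier): the distance from `⟨n,n,n⟩` to each secant cone
is `0` or `≥ 1`. `SGC ⇒ UnitDefect` (L1 gives `d = nΣ(1−κ_i) ≥ n·m_p·(1/n) = m_p ≥ 1` unless
`m_p = 0` in all modes, i.e. `S = T`). -/
def UnitDefect : Prop :=
  ∀ (n r : ℕ) (S : P n → P n → P n → ℂ), IsClosestPoint n r S → S ≠ T n → 1 ≤ sqDist (T n) S

/-- **Top three rungs** (target of the line `SGC ∧ L1 ∧ L2 ⇒ …`): at a closest point with defect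
`d < 3` one has `bR(⟨n,n,n⟩) ≤ r + ⌊d⌋`, for ALL `n` — because `d ≥ max_p m_p` (SGC) puts `R` in a
sub-format with all `m_p ≤ ⌊d⌋ ≤ 2`, whose maximal border rank is `⌊d⌋` (formats `1×1×1`, `2×2×1`,
`2×2×2`), and `T = S + R`. -/
def TopThreeRungs : Prop :=
  ∀ (n r : ℕ) (S : P n → P n → P n → ℂ), IsClosestPoint n r S → sqDist (T n) S < 3 →
    algBorderRank (T n) ≤ r + ⌊sqDist (T n) S⌋₊

/-- the composition this card proposes (skeleton shape for crux-plan):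
`CriticalGramIdentity → SubformatLocalisation → SpectralGapConjecture(all modes) → TopThreeRungs`. -/
def CardB_Composition : Prop :=
  CriticalGramIdentity → SubformatLocalisation → SpectralGapConjecture → TopThreeRungs

/-! ## Card `unit-residual-telescoping` -/

/-- the trilinear value `R(x,y,z) = Σ R_{abc} x_a y_b z_c` -/
def trilin {n : ℕ} (R : P n → P n → P n → ℂ) (x y z : P n → ℂ) : ℂ :=
  ∑ a, ∑ b, ∑ c, R a b c * x a * y b * z c

/-- unit vector in `ℂ^{P n}` -/
def IsUnit' {n : ℕ} (x : P n → ℂ) : Prop := ∑ a, ‖x a‖ ^ 2 = 1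

/-- **First lemma (provable now): TELESCOPING.** Adding the best multiple of one rank-one tensor
`x̄ ⊗ ȳ ⊗ z̄` to a rank-`≤ r` tensor lowers the squared distance by exactly `|R(x,y,z)|²`
(`R = T − S`, `x,y,z` unit): `d_{r+1} ≤ d_r − ‖R_r‖_σ²`. -/
def Telescoping : Prop :=
  ∀ (n r : ℕ) (S : P n → P n → P n → ℂ) (x y z : P n → ℂ), tensorRank S ≤ r →
    IsUnit' x → IsUnit' y → IsUnit' z →
      ∃ S' : P n → P n → P n → ℂ, tensorRank S' ≤ r + 1 ∧
        sqDist (T n) S' = sqDist (T n) S - ‖trilin (fun a b c => T n a b c - S a b c) x y z‖ ^ 2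

/-- **UNIT RESIDUAL LAW (URL) — the transfer `C⁺`.** Every NONZERO closest-point residual of
`⟨n,n,n⟩` has spectral norm `≥ 1`: some unit rank-one tensor has overlap `≥ 1` with `T − S`.
Border rank does not occur in the statement (`r < bR ⟺ S ≠ T`), so it is numerically testable at
`n = 3, 4` today; tight at `(2,5)` (Bini residual, `‖R‖_σ = 1`) and `(2,6)` (`R` = unit product). -/
def UnitResidualLaw : Prop :=
  ∀ (n r : ℕ) (S : P n → P n → P n → ℂ), IsClosestPoint n r S → S ≠ T n →
    ∃ x y z : P n → ℂ, IsUnit' x ∧ IsUnit' y ∧ IsUnit' z ∧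
      1 ≤ ‖trilin (fun a b c => T n a b c - S a b c) x y z‖

/-- **URL, proved regime (provable now from L1).** If some output direction `η` is UNUSED by the
nearest point (`η^* S_(A) = 0`, i.e. `K_A η = 0`) and `η` is a rank-one matrix `u v^*`, then the rotated
unit product built on `(u, v)` is uncovered: `|R(η̄/‖η‖, v e_k^T-type, e_k ū^T-type)| = 1`, so
`‖T − S‖_σ ≥ 1`. (Modes B, C cyclically.) -/
def URL_of_unusedRankOne : Prop :=
  ∀ (n r : ℕ) (S : P n → P n → P n → ℂ), IsClosestPoint n r S →
    ∀ (u v : Fin n → ℂ), u ≠ 0 → v ≠ 0 →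
      (∀ b c, ∑ a : P n, conj (u a.1 * conj (v a.2)) * S a b c = 0) →
        ∃ x y z : P n → ℂ, IsUnit' x ∧ IsUnit' y ∧ IsUnit' z ∧
          1 ≤ ‖trilin (fun a b c => T n a b c - S a b c) x y z‖

/-- **URL for `r ≤ 2n − 2` (provable now):** `rank K_A ≤ r` leaves `dim ker K_A ≥ n² − r ≥ n² − 2n + 2`,
and every subspace of `M_n(ℂ)` of that dimension contains a rank-one matrix (it meets the Segre
`ℙ^{n−1}×ℙ^{n−1}`, of codimension `(n−1)²`); then `URL_of_unusedRankOne` applies. -/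
def URL_lowRank : Prop :=
  ∀ (n r : ℕ) (S : P n → P n → P n → ℂ), r + 2 ≤ 2 * n → IsClosestPoint n r S →
    ∃ x y z : P n → ℂ, IsUnit' x ∧ IsUnit' y ∧ IsUnit' z ∧
      1 ≤ ‖trilin (fun a b c => T n a b c - S a b c) x y z‖

/-- the composition this card proposes: `URL ⇒ LinearDefectLaw` by telescoping from `d_{bR} = 0`
(`mem_closure_setOf_tensorRank_le_of_algBorderRank_le`), existence of closest points, and
`sup_{rank ≤ r} |⟨S,T⟩|²/‖S‖² = n³ − dist(T, σ̂_r)²`. -/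
def CardA_Composition : Prop := Telescoping → UnitResidualLaw → LinearDefectLaw

/-! ## A consequence family used as cheapest structural falsifier (both cards) -/

/-- RESTRICTION RIGIDITY (implied by the crux; the `Q = 0` stratum of L1): restricting the output
slot of `⟨n,n,n⟩` to the orthogonal complement of one direction `α ∈ ℂ^{n×n}` saves at most `n`
border multiplications. For rank-one `α` this is deletion (tight); for `α = I` at `n = 2` the truth
is `6 ≥ 5` (Strassen's `M₁ = (a₁₁+a₂₂)(b₁₁+b₂₂)` drops on traceless input; Strassen's commutator
equation gives `≥ 6`). Stated with the projected tensor `S_α = T − ᾱ ⊗ T(α)/‖α‖²`. -/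
def RestrictionRigidity : Prop :=
  ∀ (n : ℕ) (α : P n → ℂ), α ≠ 0 →
    algBorderRank (T n) ≤ algBorderRank (fun a b c => T n a b c -
      conj (α a) * (∑ a', α a' * T n a' b c) / (∑ a', ‖α a'‖ ^ 2 : ℝ)) + n

end

end Summit.MatrixMultiplication.MatrixMultiplication.Cruxes.LinearDefectLaw.Ideator1
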